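import Summits.QuantumFields.YangMills.Theorems.BalabanUVNodesN08AlphaEq324RowClassSocketEndSandwiched
import Summits.QuantumFields.YangMills.Theorems.BalabanUVNodesN08AlphaEq324RowClassSocketEndIndexed
import Literature.MathematicalPhysics.QuantumFieldTheory.Balaban1983to89.B10Eq55GaussianStepPresentation

/-!
# Route «BalabanUVNodes», Track-A DAG node N08 = [Balaban1985UV3] Thm 1 p. 257 ∕ Thm 2 p. 272 — THE (α)-SOCKET AT CELL LIT-BALABAN's LETTER FOR (55)∕(58):
# the (3.24) row `h324` at EVERY run step for an a.e. presentation of the step block by lit-balaban's `dμ_{C^{(k)}} = gaussMeasure μ Δ` on the abstract space of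
# independent variables `Ã` (a basis indexed by torus-labelled variables, the matrix of `Δ` a class member in the TORUS metric), the small-field cut-off only SANDWICHED
# between two coordinate boxes (CHECK D) (part 12 of the class socket)

Cell `pub-ymgap`, seat `pub-ymgap-dag-n08-w4` gen 6 (CLAIM-7 ∕ INTENT-7).  `bears_on: R4∕N08`; filed `--supports stmt-QuantumFields-27364` (K1⁹, helper).  THEOREMS ONLY
(def-free, sorry-free, standard axioms); part 11's `…ClassSocketEndSandwiched.exists_threshold_h324Row_freeLetter_of_expDecayPresentation_sandwichedBox_allSteps_ae`, part 8's
`…ClassSocketEndIndexed.preimage_box_ae_eq_smallFieldSet_of_nonneg`, seat n08-b's kit `…ClassTorusWindow.exists_presentation_of_torusDecay` (p639605) and seat n08-b's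
`B10Eq55GaussianStepPresentation.gaussMeasure_eq_map_gaussianFieldOfKernel ∕ preimage_box_eq ∕ posDef_toMatrix₂_of_coercive` (p647337) consumed BY NAME.

WHY.  [Balaban1985UV3] (55) p.269 ∕ (58) p.270: «we write the integral in terms of the independent variables Ã … we obtain the Gaussian integral determined by the positive
quadratic form ⟨A, C*Δ_kCA⟩».  Cell lit-balaban typed that measure as `B10Eq55GaussianStep.gaussMeasure μ Δ := Z⁻¹·e^{−½Δ(A,A)}dμ` on an abstract finite-dimensional space `S`
with a Lebesgue measure `μ` and a form `Δ`; seat n08-b's p647337 proved it IS the class field in any basis `b` (`gaussMeasure μ Δ = 𝒩(0, M⁻¹).map b.equivFun.symm`,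
`M = toMatrix₂ b b Δ`).  This part moves the socket's mouth to that letter — the one NODE 00's `(𝔖 k).μ` is most likely to be pinned to — with the member rows for `M` in the TORUS
metric of `T₁^{(k)}` (n08-b's bent window, `(Λ, e)` returned BEFORE the tower data) and the cut-off in CHECK D's SANDWICHED form (a product of `𝔤`-balls sits between the
coordinate boxes of radii `p∕λ` and `p`): `(𝔖 k).μ = (gaussMeasure μ Δ).map Ψ`, `{|A_b| ≤ p_{b₀∕λ}(g_k) ∀ b} ≤ᵐ Ψ⁻¹'χ ≤ᵐ {|A_b| ≤ p_{b₀}(g_k) ∀ b}` (`A_b = b.equivFun A b`),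
`𝒱 ∘ Ψ =ᵐ H`, Hamiltonian letters `H (b.equivFun.symm (z ∘ e)) = H^{aw}_{Jw} z` on the bent window ⟹ `StepAlphaEq324CoreLTAtAC.h324` ∕ `…CoreLTAt.h324` at the free letter.
* ★★★★ `exists_threshold_h324Row_freeLetter_of_gaussMeasureTorusPresentation_sandwichedBox_allSteps_ae`.
HONEST SCOPE.  A composition by name (kit ∘ p647337 §3 ∘ part 11): member rows for `M` ∕ `Ψ` ∕ the sandwich ∕ Hamiltonian letters ∕ window ∕ budget are HYPOTHESES; lit-balaban's
`(S, μ, Δ, b)` are ABSTRACT — the reading «`S = 𝔤^{Λ̃}`, `Δ = ⟨Ã, C*Δ_kCÃ⟩`» is lit-balaban's dictionary and the pin «`(𝔖 k).μ = gaussMeasure μ Δ` (pushed by `Ψ`)» is NODE 00's —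
THE IDENT, NOT made ∕ commissioned ∕ claimed (see this seat's located CHECK E on the h-independence of `(𝔖 k).μ`); nothing of [Balaban1985UV3] ∕ [BenfattoEtAl1978] ∕
[Balaban1985BackgroundPropagators] asserted or discharged; `PrintedUV3V` NOT proved; N08 NOT discharged; count-neutral; one finite 𝕋⁴ programme at fixed ε — R4 closes the
conditional finite-𝕋⁴ rung `BalabanLadder.UV` only; nothing continuum ∕ ℝ⁴ ∕ OS ∕ mass gap ∕ Clay.
-/

noncomputable section

namespace Summit.QuantumFields.YangMills.Theorems.BalabanUVNodesN08AlphaEq324RowClassSocketEndGaussMeasure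

open MeasureTheory
open scoped BigOperators Nat Matrix
open Literature.MathematicalPhysics.QuantumFieldTheory (gaussianFieldOfKernel)
open Literature.MathematicalPhysics.QuantumFieldTheory.Balaban1983to89
open Literature.MathematicalPhysics.QuantumFieldTheory.Balaban1983to89.B1Sect3Statements (Eq324)
open Literature.MathematicalPhysics.QuantumFieldTheory.Balaban1983to89.B1Eq324BenfattoLemma (Coef hamiltonian coefSup smallFieldSet)
open Literature.MathematicalPhysics.QuantumFieldTheory.Balaban1983to89.B1Eq324BenfattoClassPresentation (measurable_restrictAlong)
open Literature.MathematicalPhysics.QuantumFieldTheory.Balaban1983to89.B1Eq324BenfattoClassTorusWindow (exists_presentation_of_torusDecay)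
open Literature.MathematicalPhysics.QuantumFieldTheory.Balaban1983to89.B10Eq55GaussianStep (gaussMeasure)
open Literature.MathematicalPhysics.QuantumFieldTheory.Balaban1983to89.B10Eq55GaussianStepPresentation
  (gaussMeasure_eq_map_gaussianFieldOfKernel preimage_box_eq posDef_toMatrix₂_of_coercive)
open Literature.MathematicalPhysics.QuantumFieldTheory.Balaban1985CMP102.Setting
open Summit.QuantumFields.Balaban3D.Carriers
open Summit.QuantumFields.Balaban3D.Proofs.Primitives (AlphaConsts)
open Summit.QuantumFields.Balaban3D.Proofs.GroupModelLieC (lieC)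
open Summit.QuantumFields.YangMills.Theorems.BalabanUVNodesN08AlphaEq324RowClassSocketEndIndexed (preimage_box_ae_eq_smallFieldSet_of_nonneg)
open Summit.QuantumFields.YangMills.Theorems.BalabanUVNodesN08AlphaEq324RowClassSocketEndSandwiched
  (exists_threshold_h324Row_freeLetter_of_expDecayPresentation_sandwichedBox_allSteps_ae)
open Literature.Probability.LatticeModels (cumulantOf)

variable {L : ℕ} {G : Type} [GaugeGroup G] [MeasurableSpace G] [HaarData G] (𝔊 : GroupModel G) (𝔠 : AlphaConsts L 𝔊.N)

/-- ★★★★ **ROW `h324` AT EVERY RUN STEP FROM A PRESENTATION BY LIT-BALABAN's `dμ_{C^{(k)}} = gaussMeasure μ Δ`, CUT-OFF SANDWICHED.**  Scalars `d_T ≥ 1`, `m` labels, `γ_A > 0`,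
`K_T ≥ 0`, `κ_T > 0`, Hamiltonian shape `(D, ϰ > 0)`, `p₀ > 2∕3`, `σ > 0`, `c₀ ≥ 0`, `6 + 2κ₀ < σ(n̄ + 1)`: `∃ b₁ ≥ 0, ∀ b₀, ∀ λ ≥ 1, λ·b₁ < b₀ → ∃ C ≥ 0, ∀ S, ∀ k ≤ K, ∀ v
(C·v ≤ Ca + Cc)`, for every torus size `N`, variables `β ≠ ∅` with torus sites `site` and labels `lab` (jointly injective), every space `S` of independent variables (normed, Borel,
Lebesgue measure `μ` of any normalisation), basis `bs : β → S`, form `Δ` whose matrix `M = toMatrix₂ bs bs Δ` is symmetric, `γ_A`-coercive and decays like `K_T e^{−κ_T ρ}` for a `ρ`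
dominating the torus sup-distance of the sites: THERE ARE `Λ ⊂ ℤ^{2d_T+1}` and `e : β ≃ Λ` such that for EVERY tower data `𝔖`, EVERY measurable `Ψ h U : S → Fl` with
`(𝔖 k).μ = (gaussMeasure μ Δ).map (Ψ h U)`, the SANDWICH `{A | ∀ b, |bs.equivFun A b| ≤ p_{b₀∕λ}(g_k)} ≤ᵐ Ψ⁻¹'(𝔖 k).box h ≤ᵐ {A | ∀ b, |bs.equivFun A b| ≤ p_{b₀}(g_k)}`,
`𝒱 h U ∘ Ψ h U =ᵐ H h U`, Hamiltonian letters `H h U (bs.equivFun.symm (z ∘ e)) = hamiltonian s D ϰ (aw h U) (Jw h U) z` (`Jw ⊆ Λ`, `sup|coeff| ≤ c₀ g_k^σ`) and `|β| ≤ v·|T₁^{(k)}|`,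
the row `Eq324 (∫_{box h} e^{𝒱 h U} d(𝔖 k).μ) (free cumulants) n̄ (Ca + Cc) (Lᵏg₀²) (3 + κ₀) |T₁^{(k)}|` holds for every `(h, U)`.
[cite: Balaban1985UV3, (55) p.269 + (58) p.270 + p.271 + (51) p.268; Balaban1982Higgs1, (3.24) p.616; BenfattoEtAl1978, Lemma p.152 (class form; ours);
Balaban1985BackgroundPropagators, (3.155)–(3.158) pp.427–428 + p.390] -/
theorem exists_threshold_h324Row_freeLetter_of_gaussMeasureTorusPresentation_sandwichedBox_allSteps_ae {dT : ℕ} (hdT : 0 < dT) (m : ℕ)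
    {γA KT κT : ℝ} (hγA0 : 0 < γA) (hKT : 0 ≤ KT) (hκT : 0 < κT)
    (D : ℕ) {ϰ : ℝ} (hϰ : 0 < ϰ) {p₀ σ c₀ : ℝ} (hp₀ : 2 / 3 < p₀) (hσ : 0 < σ) (hc₀ : 0 ≤ c₀) (hκσ : 6 + 2 * 𝔠.κ₀ < σ * (𝔠.nbar + 1)) :
    ∃ b₁ : ℝ, 0 ≤ b₁ ∧ ∀ b₀ lam : ℝ, 1 ≤ lam → lam * b₁ < b₀ → ∃ C : ℝ, 0 ≤ C ∧
      ∀ (S : Scales L) (k : ℕ), k ≤ S.K → ∀ (v : ℝ), C * v ≤ 𝔠.Ca + 𝔠.Cc →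
        ∀ {N : ℕ} [NeZero N] {β : Type} [Fintype β] [DecidableEq β] [Nonempty β]
          (site : β → Fin dT → ZMod N) (lab : β → Fin m), (Function.Injective fun b => (site b, lab b)) →
        ∀ {Sp : Type} [NormedAddCommGroup Sp] [NormedSpace ℝ Sp] [MeasurableSpace Sp] [BorelSpace Sp]
          (μS : Measure Sp) [μS.IsAddHaarMeasure] (bs : Module.Basis β ℝ Sp) (Δ : Sp →ₗ[ℝ] Sp →ₗ[ℝ] ℝ) {ρ : β → β → ℝ},
          -- the member: the matrix of `Δ` in the basis `bs`, symmetric, `γ_A`-coercive, torus-metric decay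
          (∀ b b', LinearMap.toMatrix₂ bs bs Δ b b' = LinearMap.toMatrix₂ bs bs Δ b' b) →
          (∀ x : β → ℝ, γA * ∑ b, x b ^ 2 ≤ ∑ b, ∑ b', LinearMap.toMatrix₂ bs bs Δ b b' * x b * x b') →
          (∀ b b', |LinearMap.toMatrix₂ bs bs Δ b b'| ≤ KT * Real.exp (-(κT * ρ b b'))) →
          (∀ b b' i, (|((site b i - site b' i).valMinAbs : ℤ)| : ℝ) ≤ ρ b b') →
        ∃ (Λ : Finset (Fin (dT + dT + 1) → ℤ)) (e : β ≃ ↥Λ),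
        ∀ (𝔖 : ∀ k, StepSeries S G ↥(lieC 𝔊) (nblkOf S 𝔠.lane.carrier k) k)
          (Ψ : Hist S.P (k + 1) → GaugeField S.P (k + 1) G → Sp → (𝔖 k).Fl) (H : Hist S.P (k + 1) → GaugeField S.P (k + 1) G → Sp → ℝ)
          (s : ℕ) (Jw : Hist S.P (k + 1) → GaugeField S.P (k + 1) G → Finset (Fin (dT + dT + 1) → ℤ))
          (aw : Hist S.P (k + 1) → GaugeField S.P (k + 1) G → Coef (dT + dT + 1)),
          -- the a.e. presentation by lit-balaban's measure, the box SANDWICHED in the `bs`-coordinates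
          (∀ h U, Measurable (Ψ h U)) → (∀ h U, (𝔖 k).μ = (gaussMeasure μS Δ).map (Ψ h U)) →
          (∀ h, MeasurableSet ((𝔖 k).box h)) → (∀ h U, Measurable ((𝔖 k).𝒱 h U)) →
          (∀ h U, {A : Sp | ∀ b, |bs.equivFun A b| ≤ B10.pFun (b₀ / lam) p₀ (S.gk k)} ≤ᵐ[gaussMeasure μS Δ] Ψ h U ⁻¹' (𝔖 k).box h) →
          (∀ h U, Ψ h U ⁻¹' (𝔖 k).box h ≤ᵐ[gaussMeasure μS Δ] {A : Sp | ∀ b, |bs.equivFun A b| ≤ B10.pFun b₀ p₀ (S.gk k)}) →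
          (∀ h U, (fun A => (𝔖 k).𝒱 h U (Ψ h U A)) =ᵐ[gaussMeasure μS Δ] H h U) →
          -- the Hamiltonian letters on the bent window (class II)
          (∀ h U (z : (Fin (dT + dT + 1) → ℤ) → ℝ), H h U (bs.equivFun.symm fun b => z ((e b : ↥Λ) : Fin (dT + dT + 1) → ℤ)) =
            hamiltonian s D ϰ (aw h U) (Jw h U) z) →
          (∀ h U, Jw h U ⊆ Λ) → (∀ h U, coefSup s D (aw h U) (Jw h U) ≤ c₀ * S.gk k ^ σ) → ((Fintype.card β : ℝ) ≤ v * S.sites k) →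
          ∀ h (U : GaugeField S.P (k + 1) G),
            Eq324 (∫ ω in (𝔖 k).box h, Real.exp ((𝔖 k).𝒱 h U ω) ∂(𝔖 k).μ)
              (fun n => cumulantOf (fun m => ∫ ω, (𝔖 k).𝒱 h U ω ^ m ∂(𝔖 k).μ) n) 𝔠.nbar (𝔠.Ca + 𝔠.Cc)
              ((L : ℝ) ^ k * S.g0sq) (3 + 𝔠.κ₀) (S.sites k) := by
  have hd : 0 < dT + dT + 1 := Nat.succ_pos _
  obtain ⟨b₁, hb₁0, hb₁⟩ := exists_threshold_h324Row_freeLetter_of_expDecayPresentation_sandwichedBox_allSteps_ae 𝔊 𝔠 hd hγA0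
    (KA := KT * Real.exp (κT * m)) (κA := κT / Real.sqrt (dT + dT + 1)) (by positivity) (div_pos hκT (Real.sqrt_pos.2 (by positivity)))
    D hϰ hp₀ hσ hc₀ hκσ
  refine ⟨b₁, hb₁0, fun b₀ lam hlam hb => ?_⟩
  obtain ⟨C, hC, hEND⟩ := hb₁ b₀ lam hlam hb
  refine ⟨C, hC, ?_⟩
  intro S k hk v hCv N _ β _ _ _ site lab hinj Sp _ _ _ _ μS _ bs Δ ρ hMs hγ hdec hρ
  -- seat n08-b's torus member kit for the matrix `M` of `Δ`: bent window, bijection, the three member rows, the Gaussian bridge, the box identity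
  obtain ⟨Λ, e, hsymm, hcoer, hdecay, hbridge, hboxkit⟩ :=
    exists_presentation_of_torusDecay dT N m hdT site lab hinj hMs hγA0 hγ hKT hκT.le hdec hρ
  refine ⟨Λ, e, ?_⟩
  intro 𝔖 Ψ H s Jw aw hΨ hμ hboxm hVm hlo hhi hV hH hJΛ hA hβv
  -- lit-balaban's measure IS the class field in the basis `bs` (p647337 §3): `gaussMeasure μ Δ = 𝒩(0, M⁻¹).map bs.equivFun.symm = μ_K.map (bs.equivFun.symm ∘ (z ↦ z ∘ e))`
  have hM := posDef_toMatrix₂_of_coercive bs Δ hMs hγA0 hγ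
  have hsym : Measurable (⇑bs.equivFun.symm : (β → ℝ) → Sp) := bs.equivFunL.symm.continuous.measurable
  have hq : Measurable fun (z : (Fin (dT + dT + 1) → ℤ) → ℝ) => bs.equivFun.symm fun b => z ((e b : ↥Λ) : Fin (dT + dT + 1) → ℤ) :=
    hsym.comp (measurable_restrictAlong e)
  have hgm : gaussMeasure μS Δ = (gaussianFieldOfKernel fun x y => if hxy : x ∈ Λ ∧ y ∈ Λ then
        ((Matrix.reindex e e (LinearMap.toMatrix₂ bs bs Δ))⁻¹ : Matrix ↥Λ ↥Λ ℝ) ⟨x, hxy.1⟩ ⟨y, hxy.2⟩ else 0).map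
      (fun (z : (Fin (dT + dT + 1) → ℤ) → ℝ) => bs.equivFun.symm fun b => z ((e b : ↥Λ) : Fin (dT + dT + 1) → ℤ)) := by
    rw [gaussMeasure_eq_map_gaussianFieldOfKernel μS bs Δ hM, ← hbridge, Measure.map_map hsym (measurable_restrictAlong e)]
    rfl
  have hqmp : Measure.QuasiMeasurePreserving (fun (z : (Fin (dT + dT + 1) → ℤ) → ℝ) => bs.equivFun.symm fun b => z ((e b : ↥Λ) : Fin (dT + dT + 1) → ℤ))
      (gaussianFieldOfKernel fun x y => if hxy : x ∈ Λ ∧ y ∈ Λ then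
        ((Matrix.reindex e e (LinearMap.toMatrix₂ bs bs Δ))⁻¹ : Matrix ↥Λ ↥Λ ℝ) ⟨x, hxy.1⟩ ⟨y, hxy.2⟩ else 0) (gaussMeasure μS Δ) :=
    ⟨hq, by rw [hgm]⟩
  -- the coordinate boxes of `S` pull back to the uniform boxes of `β → ℝ`, i.e. a.e. to the class road's `smallFieldSet Λ`
  have hboxS : ∀ p : ℝ, (fun (z : (Fin (dT + dT + 1) → ℤ) → ℝ) => bs.equivFun.symm fun b => z ((e b : ↥Λ) : Fin (dT + dT + 1) → ℤ)) ⁻¹'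
        {A : Sp | ∀ b, |bs.equivFun A b| ≤ p} =ᵐ[gaussianFieldOfKernel fun x y => if hxy : x ∈ Λ ∧ y ∈ Λ then
          ((Matrix.reindex e e (LinearMap.toMatrix₂ bs bs Δ))⁻¹ : Matrix ↥Λ ↥Λ ℝ) ⟨x, hxy.1⟩ ⟨y, hxy.2⟩ else 0] smallFieldSet Λ p := fun p => by
    have hset : (fun (z : (Fin (dT + dT + 1) → ℤ) → ℝ) => bs.equivFun.symm fun b => z ((e b : ↥Λ) : Fin (dT + dT + 1) → ℤ)) ⁻¹'
        {A : Sp | ∀ b, |bs.equivFun A b| ≤ p} =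
        (fun (z : (Fin (dT + dT + 1) → ℤ) → ℝ) (b : β) => z ((e b : ↥Λ) : Fin (dT + dT + 1) → ℤ)) ⁻¹' {ω : β → ℝ | ∀ b, |ω b| ≤ p} := by
      rw [← preimage_box_eq bs p, ← Set.preimage_comp]; rfl
    rw [hset]
    exact preimage_box_ae_eq_smallFieldSet_of_nonneg e _ hboxkit p
  refine hEND S 𝔖 k hk v hCv (fun _ _ => Λ) (fun _ _ => Matrix.reindex e e (LinearMap.toMatrix₂ bs bs Δ))
    (fun _ _ x y => if hxy : x ∈ Λ ∧ y ∈ Λ then ((Matrix.reindex e e (LinearMap.toMatrix₂ bs bs Δ))⁻¹ : Matrix ↥Λ ↥Λ ℝ) ⟨x, hxy.1⟩ ⟨y, hxy.2⟩ else 0)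
    (fun h U z => Ψ h U (bs.equivFun.symm fun b => z ((e b : ↥Λ) : Fin (dT + dT + 1) → ℤ))) s (fun _ _ => Λ) Jw aw
    (fun _ _ _ _ => rfl) (fun _ _ => ⟨_, (e (Classical.arbitrary β)).2⟩) (fun _ _ => hsymm) (fun _ _ => hcoer) (fun _ _ => hdecay)
    (fun h U => (hΨ h U).comp hq) (fun h U => ?_) hboxm hVm (fun h U => ?_) (fun h U => ?_) (fun h U => ?_)
    (fun _ _ => ⟨_, (e (Classical.arbitrary β)).2⟩) hJΛ hJΛ hA (fun _ _ => ?_)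
  · rw [hμ h U, hgm, Measure.map_map (hΨ h U) hq]
    rfl
  · exact (hboxS _).symm.le.trans (hqmp.preimage_mono_ae (hlo h U))
  · have h1 := hqmp.preimage_mono_ae (hhi h U)
    rw [← Set.preimage_comp] at h1
    exact h1.trans (hboxS _).le
  · have h1 := ae_eq_comp (g := fun A => (𝔖 k).𝒱 h U (Ψ h U A)) (g' := H h U) hq.aemeasurable
      (μ := gaussianFieldOfKernel fun x y => if hxy : x ∈ Λ ∧ y ∈ Λ then
        ((Matrix.reindex e e (LinearMap.toMatrix₂ bs bs Δ))⁻¹ : Matrix ↥Λ ↥Λ ℝ) ⟨x, hxy.1⟩ ⟨y, hxy.2⟩ else 0)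
      (by rw [← hgm]; exact hV h U)
    refine h1.trans (Filter.EventuallyEq.of_eq ?_)
    funext z
    exact hH h U z
  · have : (Λ.card : ℝ) = Fintype.card β := by rw [← Fintype.card_coe]; exact_mod_cast (Fintype.card_congr e).symm
    rw [this]; exact hβv

end Summit.QuantumFields.YangMills.Theorems.BalabanUVNodesN08AlphaEq324RowClassSocketEndGaussMeasure

end
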